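/-
Copyright (c) 2026. All rights reserved.
Released under Apache 2.0 license as described in the file LICENSE.
-/
import Mathlib
import Literature.LinearAlgebra.Matrix.CrossInterpolation
import Literature.LinearAlgebra.Matrix.RankMinors
import Literature.LinearAlgebra.Matrix.MaximalVolumeErrorBounds
import Literature.LinearAlgebra.Matrix.AdaptiveCrossApproximation
import Literature.LinearAlgebra.Matrix.CrossPivotInverseGrowth
import Literature.LinearAlgebra.Matrix.PosSemidefCrossApproximation

/-!
# Cross approximation with complete pivoting: the error bound with an explicit growth factor,
  and diagonally dominant matrices

[CortinovisKressnerMassei2020] A. Cortinovis, D. Kressner, S. Massei, *On maximum volume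
submatrices and cross approximation for symmetric semidefinite and diagonally dominant matrices*,
Linear Algebra Appl. 593 (2020) 251–268 (theorem / remark numbering of arXiv:1902.02283, as in
`PivotedCholeskyErrorBound`) — §3 (Algorithm 1: cross approximation with complete pivoting =
LU with complete pivoting; Remark 5), §3.1 (growth factor `ρ_k`, Theorems 6 and 7), §3.3
(diagonally dominant matrices: `ρ_k ≤ 2`, Corollary 9); [GolubVanLoan2013, §4.1.1 Theorem 4.1.1]
and [Higham2011, §"LU Factorization", §"Structured Matrices"] (diagonal dominance is inherited by
the Schur complement; no pivot growth beyond `2`); [HornJohnson2013, §6.1 Definition 6.1.9]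
(diagonal dominance); [Bebendorf2000, §2 Lemma 2] and [NunezFernandezEtAl2025, §3.3.1] (nested
cross interpolation, full / rook pivot search).

This file continues `AdaptiveCrossApproximation` (column / row / rook pivoting and the
`2^k`-growth of the cross coefficients), `CrossPivotInverseGrowth` (growth of the inverse pivot
block, distance to singularity) and `PosSemidefCrossApproximation` / `PivotedCholeskyErrorBound`
(the SPSD case, `ρ = 1`), and formalises the GENERAL-MATRIX error bound of cross approximation
with complete pivoting, [CortinovisKressnerMassei2020, Theorem 7], with the growth factor as an
explicit hypothesis, together with its specialisation to DIAGONALLY DOMINANT matrices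
(`ρ ≤ 2`, [CortinovisKressnerMassei2020, §3.3]).

## Contents

* `crossPivot A r c : Fin k → K` — the pivot sequence `p_k, …, p_1` of a nested cross
  approximation built with `vecCons` (newest first), `crossPivot A (vecCons i r) (vecCons j c) 0 =
  (A - Ã_{r,c}) i j`; `IsColumnPivoted.det_submatrix_eq_prod_crossPivot`: `det A[r, c] = ∏ₛ pₛ`.
* `IsCompletePivoted A r c` — Algorithm 1: every new pivot is a nonzero residual entry of
  maximum modulus in the whole residual; it is a rook sequence (`.isRookPivoted`), its pivot
  block is invertible, `.cons_inv` / `IsRookPivoted.cons_inv` invert the last step, `.transpose`,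
  `.le_rank`, `.crossInterp_ne_self_iff` (residual `≠ 0 ↔ k < rank A`), and
  `.norm_sub_crossInterp_le_norm_crossPivot_zero`: `‖A - Ã_k‖_max ≤ |p_{k+1}|`.
* GROWTH OF THE INVERSE PIVOT BLOCK along a rook-pivoted sequence with all pivots of modulus
  `≥ μ`: `IsRookPivoted.sum_norm_inv_submatrix_le_of_forall_le`,
  `Σ_{a,b} ‖(A[r,c])⁻¹ a b‖ ≤ (4^k - 1)/(3μ)`; hence `IsRookPivoted.le_mul_of_rank_le`: if `A` is
  entrywise `δ`-close to a matrix of rank `≤ k`, the smallest of `k + 1` pivots has modulus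
  `≤ (4^{k+1} - 1)/3 · δ` (the entrywise replacement of
  `min |pᵢ| ≤ 2^{2m+1} ‖A₁₁⁻¹‖⁻¹_{∞→1} ≤ 2^{2m+1} γ_m(A)` in the proof of Theorem 7).
* THEOREM 7 WITH EXPLICIT GROWTH FACTOR: `IsRookPivoted.norm_sub_crossInterp_le_mul_of_rank_le`
  / `IsCompletePivoted.norm_sub_crossInterp_le_mul_of_rank_le` — if the `(k+1)`-st complete pivot
  satisfies `|p_{k+1}| ≤ ρ |pₛ|` for all `s` and `‖A - F‖_max ≤ δ` for some `F` of rank `≤ k`,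
  then `‖A - Ã_k‖_max ≤ ρ (4^{k+1} - 1)/3 · δ ≤ 2^{2k+1} ρ δ`
  (`…_le_two_pow_mul_of_rank_le`; printed: `2^{2m+1} ρ_m γ_m(A)`), and the lower-bound reading
  `IsCompletePivoted.norm_crossPivot_zero_le_mul_of_rank_le`.
* SPSD: `IsDiagPivoted.isCompletePivoted` — for a real symmetric positive semidefinite matrix a
  diagonally pivoted sequence (pivoted Cholesky) is completely pivoted (Remark 5).
* DIAGONALLY DOMINANT MATRICES (by rows, `∀ i, ∑ j ∈ univ.erase i, ‖A i j‖ ≤ ‖A i i‖`, over any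
  normed field): one step of Gaussian elimination with a pivot in a diagonally dominant row does
  not increase absolute row sums (`sum_norm_sub_mul_inv_mul_le_sum_norm`) and preserves row
  diagonal dominance (`sum_erase_norm_sub_mul_inv_mul_le_norm`); a diagonal cross step IS such an
  elimination step (`sub_crossInterp_vecCons_vecCons_self_apply`); hence along a completely
  pivoted diagonal sequence the residual stays row diagonally dominant
  (`IsCompletePivoted.sum_erase_norm_sub_crossInterp_le`), its absolute row sums do not exceed
  those of `A` (`.sum_norm_sub_crossInterp_le_sum_norm`), NO GROWTH BEYOND `2`
  (`.norm_sub_crossInterp_le_two_mul_norm_diag`: `‖(A - Ã) x y‖ ≤ 2 ‖A x x‖`;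
  `.norm_crossPivot_zero_le_two_mul`: `|p_{k+1}| ≤ 2 |pₛ|`), the diagonal search is complete
  pivoting and never gets stuck before the residual vanishes (`.cons_of_rowDiagDominant`,
  `.exists_cons_of_rowDiagDominant`), and THE ERROR BOUND
  `IsCompletePivoted.norm_sub_crossInterp_le_of_rowDiagDominant_of_rank_le`:
  `‖A - Ã_k‖_max ≤ 2 (4^{k+1} - 1)/3 · δ ≤ 2^{2k+2} δ` for every `F` of rank `≤ k` with
  `‖A - F‖_max ≤ δ` (Theorem 7 with `ρ_m ≤ 2`; the column diagonally dominant version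
  `…_of_colDiagDominant_of_rank_le` by transposition).

## Dictionary (paper ↔ Lean)

* `A^{(k)}` / `R_k` (residual after `k` steps of Algorithm 1) ↔ `A - crossInterp A r c` with
  `r, c : Fin k → _` the chosen rows / columns, newest first; `p_{k+1} = R_k(i_{k+1}, j_{k+1})` ↔
  `crossPivot A (vecCons i r) (vecCons j c) 0`.
* `γ_m(A) = min{‖E‖_max : rank (A + E) ≤ m}` ↔ any `δ` with `∀ a b, ‖A a b - F a b‖ ≤ δ` for some
  `F` with `F.rank ≤ k` (`m = k`); the theorems hold for every such pair `(F, δ)`, in particular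
  for a minimiser.
* `ρ_m` (supremum of `‖A^{(k)}‖_max / ‖A‖_max` over a matrix class) ↔ an explicit hypothesis
  `∀ s, ‖p_{k+1}‖ ≤ ρ ‖pₛ‖` on the run at hand; for row diagonally dominant matrices the file
  PROVES `ρ = 2` works (`IsCompletePivoted.norm_crossPivot_zero_le_two_mul`), for SPSD matrices
  `ρ = 1` is `IsDiagPivoted.pivot_le_pivot` of `PivotedCholeskyErrorBound`.
* The spectral- or `(∞→1)`-norm growth `‖L₁₁⁻¹‖ ‖U₁₁⁻¹‖ ≤ 2^{2m+1}/min|pᵢ|` ↔ the entry-sum bound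
  `Σ‖(A[r,c])⁻¹‖ ≤ (4^{k+1} - 1)/(3 min|pᵢ|)` (bordered-inverse recursion of
  `CrossPivotInverseGrowth`), giving the constant `(4^{k+1} - 1)/3 ≤ 2^{2k+1}`.

## Not formalised

Singular values: Theorem 6 (`4^m ρ_m σ_{m+1}(A)`) and Corollaries 8–10 AS PRINTED (in terms of
`σ_{m+1}`, resp. the sharper DD constants `(m+1) 2^{m+1}` of Corollary 9 and `2(m+1)^2` of
Corollary 10 for doubly DD matrices, which rest on `‖U₁₁⁻¹‖ ≤ m + 1` for DD triangular factors);
the universal growth factors `ρ_k` themselves (Wilkinson's bound for complete pivoting,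
"`ρ_k ≤ 2` for DD matrices" as a statement about all matrices of the class — here proved run by
run); §2 (maximum volume: Theorem 1, Lemma 3, Theorem 4) and §3.4–§4 (tightness examples,
functions).  Mathlib has no singular value decomposition, so every `σ`-statement is replaced by
its entrywise (`γ_m`, Chebyshev) counterpart, exactly as in `MaximalVolumeErrorBounds` and
`PivotedCholeskyErrorBound`.
-/

namespace Literature.LinearAlgebra.Matrix

open _root_.Matrix Finset

/-! ### The pivot sequence of a greedy cross approximation -/

section CommRing

variable {K : Type*} [CommRing K] {m n : Type*}

/-- [cite: CortinovisKressnerMassei2020, §3 Algorithm 1 (line 5: `p_{k+1} := R_k(i_{k+1}, j_{k+1})`,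
with `R_k = A - Ã_k` the residual after `k` cross steps, line 6)];
[cite: Bebendorf2000, §2 Lemma 2]
The PIVOT SEQUENCE of a nested (greedy) cross approximation.  Pivot sequences are built with
`Matrix.vecCons`, the most recent pivot in front; `crossPivot A r c s` is the residual entry that
was chosen when the pivot in position `s` was appended, i.e. for `r = (i_k, …, i_1)`,
`c = (j_k, …, j_1)` one has `crossPivot A r c 0 = (A - Ã_{k-1}) i_k j_k = p_k`, …,
`crossPivot A r c (k-1) = A i_1 j_1 = p_1`. -/
noncomputable def crossPivot (A : Matrix m n K) :
    ∀ {k : ℕ}, (Fin k → m) → (Fin k → n) → Fin k → K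
  | 0, _, _ => ![]
  | _ + 1, r, c =>
      vecCons ((A - crossInterp A (vecTail r) (vecTail c)) (vecHead r) (vecHead c))
        (crossPivot A (vecTail r) (vecTail c))

variable {k : ℕ}

/-- [cite: CortinovisKressnerMassei2020, §3 Algorithm 1 (line 5)] The newest pivot is the
residual entry at the newest cross. -/
@[simp]
theorem crossPivot_cons_zero (A : Matrix m n K) (r : Fin k → m) (c : Fin k → n) (i : m)
    (j : n) : crossPivot A (vecCons i r) (vecCons j c) 0 = (A - crossInterp A r c) i j := by
  simp [crossPivot]

/-- [cite: CortinovisKressnerMassei2020, §3 Algorithm 1 (line 5)] The older pivots are those of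
the shorter sequence. -/
@[simp]
theorem crossPivot_cons_succ (A : Matrix m n K) (r : Fin k → m) (c : Fin k → n) (i : m)
    (j : n) (s : Fin k) :
    crossPivot A (vecCons i r) (vecCons j c) s.succ = crossPivot A r c s := by
  simp [crossPivot]

/-- [cite: NunezFernandezEtAl2025, §3.1] With no pivots the cross interpolation is `0`. -/
@[simp]
theorem crossInterp_of_isEmpty {ι : Type*} [Fintype ι] [DecidableEq ι] [IsEmpty ι]
    (A : Matrix m n K) (r : ι → m) (c : ι → n) : crossInterp A r c = 0 := by
  ext x y
  simp [crossInterp_def, Matrix.mul_apply]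

end CommRing

/-! ### Complete pivoting -/

section NormedField

variable {K : Type*} [NormedField K] {m n : Type*} {k : ℕ}

/-- [cite: CortinovisKressnerMassei2020, §3 Algorithm 1 (cross approximation with complete
pivoting: line 3, `(i_{k+1}, j_{k+1}) := arg max_{i,j} |R_k(i,j)|`)];
[cite: NunezFernandezEtAl2025, §3.3.1 (full search)] A pivot sequence is COMPLETELY PIVOTED
(full pivoting) if every new pivot is a nonzero residual entry of maximum modulus in the WHOLE
current residual `A - Ã`.  (Ties may be broken arbitrarily; the predicate records one admissible
run of the algorithm.) -/
inductive IsCompletePivoted (A : Matrix m n K) : ∀ {k : ℕ}, (Fin k → m) → (Fin k → n) → Prop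
  /-- The empty pivot sequence is completely pivoted.
  [cite: CortinovisKressnerMassei2020, §3 Algorithm 1 (line 1, `R_0 := A`)] -/
  | nil : IsCompletePivoted A ![] ![]
  /-- Adjoining a cross `(i, j)` with `0 ≠ |(A - Ã) i j| = max_{x,y} |(A - Ã) x y|`.
  [cite: CortinovisKressnerMassei2020, §3 Algorithm 1 (lines 3–5)] -/
  | cons {k : ℕ} {r : Fin k → m} {c : Fin k → n} {i : m} {j : n} :
      IsCompletePivoted A r c → (A - crossInterp A r c) i j ≠ 0 →
      (∀ x y, ‖(A - crossInterp A r c) x y‖ ≤ ‖(A - crossInterp A r c) i j‖) →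
      IsCompletePivoted A (vecCons i r) (vecCons j c)

/-- [cite: CortinovisKressnerMassei2020, §3 Algorithm 1]; [cite: NunezFernandezEtAl2025, §3.3.1]
A complete pivot is in particular a rook pivot (maximal in its row and in its column). -/
theorem IsCompletePivoted.isRookPivoted {A : Matrix m n K} {r : Fin k → m} {c : Fin k → n}
    (h : IsCompletePivoted A r c) : IsRookPivoted A r c := by
  induction h with
  | nil => exact .nil
  | cons _ hne hmax ih => exact ih.cons_of_forall hne hmax

/-- [cite: CortinovisKressnerMassei2020, §3 Algorithm 1]; [cite: Bebendorf2000, §2 Lemma 2]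
The pivot block of a completely pivoted sequence is invertible. -/
theorem IsCompletePivoted.isUnit_det {A : Matrix m n K} {r : Fin k → m} {c : Fin k → n}
    (h : IsCompletePivoted A r c) : IsUnit (A.submatrix r c).det :=
  h.isRookPivoted.isColumnPivoted.isUnit_det

/-- [cite: Bebendorf2000, §2 Lemma 2]; [cite: CortinovisKressnerMassei2020, §3 (the
determinant identity `det A(Ĩ, J̃) = det A(I, J) · A^{(k)}(ĩ, j̃)` preceding Algorithm 1), §3.1
proof of Theorem 6 (the pivots `p_j` are the diagonal entries of the factor `L₁₁` of
`A₁₁ = L₁₁ U₁₁`)] The determinant of the pivot block is the product of the pivots,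
`det A[r, c] = ∏ₛ pₛ` (for any nested sequence with nonzero pivots, here: a column-pivoted
one). -/
theorem IsColumnPivoted.det_submatrix_eq_prod_crossPivot {A : Matrix m n K} {r : Fin k → m}
    {c : Fin k → n} (h : IsColumnPivoted A r c) :
    (A.submatrix r c).det = ∏ s, crossPivot A r c s := by
  induction h with
  | nil => simp
  | @cons k r c i j h _ _ ih =>
    rw [det_submatrix_vecCons_vecCons A r c h.isUnit_det i j, ih, Fin.prod_univ_succ,
      crossPivot_cons_zero]
    simp only [crossPivot_cons_succ]
    ring

/-- [cite: Bebendorf2000, §2 Lemma 2]; [cite: CortinovisKressnerMassei2020, §3 (determinant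
identity preceding Algorithm 1)] `det A[r, c] = ∏ₛ pₛ` for a completely pivoted sequence. -/
theorem IsCompletePivoted.det_submatrix_eq_prod_crossPivot {A : Matrix m n K} {r : Fin k → m}
    {c : Fin k → n} (h : IsCompletePivoted A r c) :
    (A.submatrix r c).det = ∏ s, crossPivot A r c s :=
  h.isRookPivoted.isColumnPivoted.det_submatrix_eq_prod_crossPivot

/-- [cite: CortinovisKressnerMassei2020, §3 Algorithm 1] Inversion of the last step of a
completely pivoted sequence. -/
theorem IsCompletePivoted.cons_inv {A : Matrix m n K} {r : Fin k → m} {c : Fin k → n} {i : m}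
    {j : n} (h : IsCompletePivoted A (vecCons i r) (vecCons j c)) :
    IsCompletePivoted A r c ∧ (A - crossInterp A r c) i j ≠ 0 ∧
      ∀ x y, ‖(A - crossInterp A r c) x y‖ ≤ ‖(A - crossInterp A r c) i j‖ := by
  generalize hr : vecCons i r = r' at h
  generalize hc : vecCons j c = c' at h
  cases h with
  | @cons k' r₀ c₀ i₀ j₀ h₀ hne hmax =>
    have hi : i = i₀ := by simpa using congr_fun hr 0
    have hr₀ : r = r₀ := by
      funext t
      simpa using congr_fun hr t.succ
    have hj : j = j₀ := by simpa using congr_fun hc 0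
    have hc₀ : c = c₀ := by
      funext t
      simpa using congr_fun hc t.succ
    subst hi hr₀ hj hc₀
    exact ⟨h₀, hne, hmax⟩

/-- [cite: NunezFernandezEtAl2025, §3.3.1 (rook search)] Inversion of the last step of a rook
pivoted sequence. -/
theorem IsRookPivoted.cons_inv {A : Matrix m n K} {r : Fin k → m} {c : Fin k → n} {i : m}
    {j : n} (h : IsRookPivoted A (vecCons i r) (vecCons j c)) :
    IsRookPivoted A r c ∧ (A - crossInterp A r c) i j ≠ 0 ∧
      (∀ x, ‖(A - crossInterp A r c) x j‖ ≤ ‖(A - crossInterp A r c) i j‖) ∧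
      ∀ y, ‖(A - crossInterp A r c) i y‖ ≤ ‖(A - crossInterp A r c) i j‖ := by
  generalize hr : vecCons i r = r' at h
  generalize hc : vecCons j c = c' at h
  cases h with
  | @cons k' r₀ c₀ i₀ j₀ h₀ hne hcol hrow =>
    have hi : i = i₀ := by simpa using congr_fun hr 0
    have hr₀ : r = r₀ := by
      funext t
      simpa using congr_fun hr t.succ
    have hj : j = j₀ := by simpa using congr_fun hc 0
    have hc₀ : c = c₀ := by
      funext t
      simpa using congr_fun hc t.succ
    subst hi hr₀ hj hc₀
    exact ⟨h₀, hne, hcol, hrow⟩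

/-- [cite: CortinovisKressnerMassei2020, §3.1 proof of Theorem 6
(`‖A - A(:,J)A(I,J)⁻¹A(I,:)‖_max = ‖A^{(m)}‖_max = |p_{m+1}|`)] With complete pivoting the error
after `k` steps is bounded entrywise by the modulus of the next pivot. -/
theorem IsCompletePivoted.norm_sub_crossInterp_le_norm_crossPivot_zero {A : Matrix m n K}
    {r : Fin k → m} {c : Fin k → n} {i : m} {j : n}
    (h : IsCompletePivoted A (vecCons i r) (vecCons j c)) (x : m) (y : n) :
    ‖(A - crossInterp A r c) x y‖ ≤ ‖crossPivot A (vecCons i r) (vecCons j c) 0‖ := by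
  rw [crossPivot_cons_zero]
  exact h.cons_inv.2.2 x y

/-! ### Growth of the inverse pivot block along a rook-pivoted sequence -/

/-- [cite: CortinovisKressnerMassei2020, §3.1 proofs of Theorem 6 (`‖L₁₁⁻¹‖ ≤ 2^m / min |pᵢ|`,
`‖U₁₁⁻¹‖ ≤ 2^m`, after [Higham1987, Theorem 6.1]) and Theorem 7
(`‖L₁₁⁻¹‖_{∞→1} ≤ (2^{m+1} - 1) / min |pᵢ|`, `‖U₁₁⁻¹‖_{1→1} ≤ 2^m`, hence
`‖A₁₁⁻¹‖_max ≤ 2^{2m+1} / min |pᵢ|`)] Entrywise replacement of these norm estimates: along a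
ROOK-pivoted sequence whose pivots all have modulus `≥ μ > 0`, the absolute entry sum of the
inverse pivot block is at most `(4ᵏ - 1) / (3 μ)`.  (Induction on the bordered-inverse recursion
`Σ‖(A[r⁺,c⁺])⁻¹‖ ≤ Σ‖(A[r,c])⁻¹‖ + 4ᵏ/|p_{k+1}|` of `CrossPivotInverseGrowth`.) -/
theorem IsRookPivoted.sum_norm_inv_submatrix_le_of_forall_le {A : Matrix m n K} :
    ∀ {k : ℕ} {r : Fin k → m} {c : Fin k → n}, IsRookPivoted A r c → ∀ {μ : ℝ}, 0 < μ →
      (∀ s, μ ≤ ‖crossPivot A r c s‖) →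
      ∑ a, ∑ b, ‖(A.submatrix r c)⁻¹ a b‖ ≤ (4 ^ k - 1) / (3 * μ) := by
  intro k r c h
  induction h with
  | nil =>
    intro μ _ _
    simp
  | @cons k r c i j h hne _ _ ih =>
    intro μ hμ hle
    have h0 : μ ≤ ‖(A - crossInterp A r c) i j‖ := by simpa using hle 0
    have h1 := h.sum_norm_inv_submatrix_vecCons_vecCons_le hne
    have h2 := ih hμ fun s => by simpa using hle s.succ
    have h3 : (4 : ℝ) ^ k / ‖(A - crossInterp A r c) i j‖ ≤ 4 ^ k / μ :=
      div_le_div_of_nonneg_left (by positivity) hμ h0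
    calc ∑ a, ∑ b, ‖(A.submatrix (vecCons i r) (vecCons j c))⁻¹ a b‖
        ≤ (4 ^ k - 1) / (3 * μ) + 4 ^ k / μ := h1.trans (add_le_add h2 h3)
      _ = (4 ^ (k + 1) - 1) / (3 * μ) := by
        rw [pow_succ]
        field_simp
        ring

/-- [cite: CortinovisKressnerMassei2020, §3.1 proof of Theorem 7 (`min{|p_1|, …, |p_{m+1}|} ≤
2^{2m+1} ‖A₁₁⁻¹‖⁻¹_{∞→1} = 2^{2m+1} γ_m(A₁₁) ≤ 2^{2m+1} γ_m(A)`, via the distance to singularity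
`γ_{n-1}(A) = ‖A⁻¹‖⁻¹_{∞→1}`)] Entrywise form: if `A` is entrywise `δ`-close to a matrix `F` of
rank `≤ k`, then along any rook-pivoted sequence of length `k + 1` the smallest pivot modulus
`μ` satisfies `μ ≤ (4^{k+1} - 1)/3 · δ` — because `F[r, c]` is singular and within entrywise
distance `δ` of the invertible `A[r, c]`, whose inverse has entry sum `≤ (4^{k+1} - 1)/(3μ)`
(`Literature.LinearAlgebra.Matrix.one_le_mul_sum_norm_inv_of_det_eq_zero`). -/
theorem IsRookPivoted.le_mul_of_rank_le [Fintype n] {A : Matrix m n K} {r : Fin (k + 1) → m}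
    {c : Fin (k + 1) → n} (h : IsRookPivoted A r c) {μ : ℝ} (hμ : 0 < μ)
    (hle : ∀ s, μ ≤ ‖crossPivot A r c s‖) (F : Matrix m n K) (hF : F.rank ≤ k) {δ : ℝ}
    (hδ : ∀ a b, ‖A a b - F a b‖ ≤ δ) : μ ≤ (4 ^ (k + 1) - 1) / 3 * δ := by
  have hP : IsUnit (A.submatrix r c).det := h.isColumnPivoted.isUnit_det
  have hFdet : (F.submatrix r c).det = 0 :=
    det_submatrix_eq_zero_of_rank_lt_card F r c (by simp; omega)
  have hdist : 1 ≤ δ * ∑ a, ∑ b, ‖(A.submatrix r c)⁻¹ a b‖ :=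
    one_le_mul_sum_norm_inv_of_det_eq_zero hP hFdet fun a b => by
      simpa using hδ (r a) (c b)
  have hsum := h.sum_norm_inv_submatrix_le_of_forall_le hμ hle
  have hδ0 : 0 ≤ δ := (norm_nonneg _).trans (hδ (r 0) (c 0))
  have h1 : 1 ≤ δ * ((4 ^ (k + 1) - 1) / (3 * μ)) :=
    hdist.trans (mul_le_mul_of_nonneg_left hsum hδ0)
  rw [← mul_div_assoc, le_div_iff₀ (by positivity), one_mul] at h1
  linarith

/-- [folklore] `p ≤ ρ p` with `p > 0` forces `1 ≤ ρ`. -/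
private theorem one_le_of_le_mul_self {p ρ : ℝ} (hp : 0 < p) (h : p ≤ ρ * p) : 1 ≤ ρ :=
  le_of_mul_le_mul_right (by simpa using h) hp

/-- [folklore] `(4^{k+1} - 1)/3 ≤ 2^{2k+1}`. -/
private theorem four_pow_succ_sub_one_div_three_le (k : ℕ) :
    ((4 : ℝ) ^ (k + 1) - 1) / 3 ≤ 2 ^ (2 * k + 1) := by
  have h4 : (4 : ℝ) ^ (k + 1) = 2 ^ (2 * k + 1) * 2 := by
    rw [show (4 : ℝ) = 2 ^ 2 by norm_num, ← pow_mul, ← pow_succ]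
    ring_nf
  rw [h4, div_le_iff₀ (by norm_num : (0 : ℝ) < 3)]
  have : (0 : ℝ) ≤ 2 ^ (2 * k + 1) := by positivity
  linarith

/-! ### The error bound of cross approximation with complete pivoting (explicit growth factor) -/

/-- [cite: CortinovisKressnerMassei2020, §3.1 Theorem 7 (`‖A - A(:,J)A(I,J)⁻¹A(I,:)‖_max ≤
2^{2m+1} ρ_m γ_m(A)`, `γ_m(A) = min{‖E‖_max : rank (A + E) ≤ m}`; with the growth factor made an
explicit hypothesis: printed, `ρ_m` is the supremum of `‖A^{(k)}‖_max / ‖A‖_max` over the class,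
here `ρ` is any bound valid for THIS run, `|p_{k+1}| ≤ ρ |pₛ|` for all pivots of the sequence)]
THEOREM 7 WITH EXPLICIT GROWTH FACTOR.  Let `(i, r), (j, c)` be a rook-pivoted sequence of
`k + 1` crosses whose last pivot `p_{k+1} = (A - Ã_k) i j` has maximum modulus in the whole
residual `A - Ã_k` (complete pivoting in the last step), and suppose `|p_{k+1}| ≤ ρ |pₛ|` for
every pivot of the sequence.  If `A` is entrywise `δ`-close to some matrix `F` of rank `≤ k`
(so `δ` may be taken to be `γ_k(A)`), then `‖A - Ã_k‖_max ≤ ρ · (4^{k+1} - 1)/3 · δ`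
(`≤ 2^{2k+1} ρ δ`, the printed constant with `m = k`).  The `(∞→1)`-norm estimate
`‖A₁₁⁻¹‖ ≤ 2^{2m+1}/min |pᵢ|` of the printed proof is replaced by the entry-sum bound
`(4^{m+1} - 1)/(3 min |pᵢ|)` of `IsRookPivoted.sum_norm_inv_submatrix_le_of_forall_le`. -/
theorem IsRookPivoted.norm_sub_crossInterp_le_mul_of_rank_le [Fintype n] {A : Matrix m n K}
    {r : Fin k → m} {c : Fin k → n} {i : m} {j : n}
    (h : IsRookPivoted A (vecCons i r) (vecCons j c))
    (hmax : ∀ x y, ‖(A - crossInterp A r c) x y‖ ≤ ‖(A - crossInterp A r c) i j‖) {ρ : ℝ}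
    (hρ : ∀ s, ‖(A - crossInterp A r c) i j‖ ≤ ρ * ‖crossPivot A (vecCons i r) (vecCons j c) s‖)
    (F : Matrix m n K) (hF : F.rank ≤ k) {δ : ℝ} (hδ : ∀ a b, ‖A a b - F a b‖ ≤ δ) (x : m)
    (y : n) : ‖(A - crossInterp A r c) x y‖ ≤ ρ * ((4 ^ (k + 1) - 1) / 3) * δ := by
  obtain ⟨_, hne, -, -⟩ := h.cons_inv
  have hp : 0 < ‖(A - crossInterp A r c) i j‖ := norm_pos_iff.mpr hne
  have hρ1 : 1 ≤ ρ := one_le_of_le_mul_self hp (by simpa using hρ 0)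
  have hρ0 : 0 < ρ := one_pos.trans_le hρ1
  have hle : ∀ s,
      ‖(A - crossInterp A r c) i j‖ / ρ ≤ ‖crossPivot A (vecCons i r) (vecCons j c) s‖ :=
    fun s => (div_le_iff₀ hρ0).mpr (by rw [mul_comm]; exact hρ s)
  have hμ := h.le_mul_of_rank_le (div_pos hp hρ0) hle F hF hδ
  rw [div_le_iff₀ hρ0] at hμ
  calc ‖(A - crossInterp A r c) x y‖ ≤ ‖(A - crossInterp A r c) i j‖ := hmax x y
    _ ≤ (4 ^ (k + 1) - 1) / 3 * δ * ρ := hμ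
    _ = ρ * ((4 ^ (k + 1) - 1) / 3) * δ := by ring

/-- [cite: CortinovisKressnerMassei2020, §3.1 Theorem 7 (explicit growth factor; Algorithm 1 =
complete pivoting in every step)] Theorem 7 for a completely pivoted sequence of `k + 1` crosses:
if `|p_{k+1}| ≤ ρ |pₛ|` for all `s` and `A` is entrywise `δ`-close to rank `≤ k`, then
`‖A - Ã_k‖_max ≤ ρ (4^{k+1} - 1)/3 · δ`. -/
theorem IsCompletePivoted.norm_sub_crossInterp_le_mul_of_rank_le [Fintype n] {A : Matrix m n K}
    {r : Fin k → m} {c : Fin k → n} {i : m} {j : n}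
    (h : IsCompletePivoted A (vecCons i r) (vecCons j c)) {ρ : ℝ}
    (hρ : ∀ s, ‖crossPivot A (vecCons i r) (vecCons j c) 0‖ ≤
      ρ * ‖crossPivot A (vecCons i r) (vecCons j c) s‖)
    (F : Matrix m n K) (hF : F.rank ≤ k) {δ : ℝ} (hδ : ∀ a b, ‖A a b - F a b‖ ≤ δ) (x : m)
    (y : n) : ‖(A - crossInterp A r c) x y‖ ≤ ρ * ((4 ^ (k + 1) - 1) / 3) * δ :=
  h.isRookPivoted.norm_sub_crossInterp_le_mul_of_rank_le h.cons_inv.2.2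
    (fun s => by simpa using hρ s) F hF hδ x y

/-- [cite: CortinovisKressnerMassei2020, §3.1 Theorem 7 (the printed shape
`2^{2m+1} · ρ_m · γ_m(A)`, `m = k`)] Theorem 7 with the printed power of two:
`‖A - Ã_k‖_max ≤ 2^{2k+1} ρ δ` (from `(4^{k+1} - 1)/3 ≤ 2^{2k+1}`). -/
theorem IsCompletePivoted.norm_sub_crossInterp_le_two_pow_mul_of_rank_le [Fintype n]
    {A : Matrix m n K} {r : Fin k → m} {c : Fin k → n} {i : m} {j : n}
    (h : IsCompletePivoted A (vecCons i r) (vecCons j c)) {ρ : ℝ}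
    (hρ : ∀ s, ‖crossPivot A (vecCons i r) (vecCons j c) 0‖ ≤
      ρ * ‖crossPivot A (vecCons i r) (vecCons j c) s‖)
    (F : Matrix m n K) (hF : F.rank ≤ k) {δ : ℝ} (hδ : ∀ a b, ‖A a b - F a b‖ ≤ δ) (x : m)
    (y : n) : ‖(A - crossInterp A r c) x y‖ ≤ 2 ^ (2 * k + 1) * ρ * δ := by
  obtain ⟨_, hne, -⟩ := h.cons_inv
  have hp : 0 < ‖(A - crossInterp A r c) i j‖ := norm_pos_iff.mpr hne
  have hρ1 : 1 ≤ ρ := one_le_of_le_mul_self hp (by simpa using hρ 0)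
  have hδ0 : 0 ≤ δ := (norm_nonneg _).trans (hδ x y)
  calc ‖(A - crossInterp A r c) x y‖ ≤ ρ * ((4 ^ (k + 1) - 1) / 3) * δ :=
      h.norm_sub_crossInterp_le_mul_of_rank_le hρ F hF hδ x y
    _ ≤ ρ * 2 ^ (2 * k + 1) * δ :=
      mul_le_mul_of_nonneg_right (mul_le_mul_of_nonneg_left
        (four_pow_succ_sub_one_div_three_le k) (zero_le_one.trans hρ1)) hδ0
    _ = 2 ^ (2 * k + 1) * ρ * δ := by ring

/-- [cite: CortinovisKressnerMassei2020, §3.1 Theorem 7 (lower-bound reading: the pivot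
certifies the distance `γ_k(A)` to rank `≤ k` from below)] If complete pivoting finds a
`(k+1)`-st pivot with `|p_{k+1}| ≤ ρ |pₛ|` for all `s`, then NO matrix of rank `≤ k` is entrywise
closer to `A` than `|p_{k+1}| / (ρ (4^{k+1} - 1)/3)`. -/
theorem IsCompletePivoted.norm_crossPivot_zero_le_mul_of_rank_le [Fintype n] {A : Matrix m n K}
    {r : Fin k → m} {c : Fin k → n} {i : m} {j : n}
    (h : IsCompletePivoted A (vecCons i r) (vecCons j c)) {ρ : ℝ}
    (hρ : ∀ s, ‖crossPivot A (vecCons i r) (vecCons j c) 0‖ ≤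
      ρ * ‖crossPivot A (vecCons i r) (vecCons j c) s‖)
    (F : Matrix m n K) (hF : F.rank ≤ k) {δ : ℝ} (hδ : ∀ a b, ‖A a b - F a b‖ ≤ δ) :
    ‖crossPivot A (vecCons i r) (vecCons j c) 0‖ ≤ ρ * ((4 ^ (k + 1) - 1) / 3) * δ := by
  rw [crossPivot_cons_zero]
  exact h.norm_sub_crossInterp_le_mul_of_rank_le hρ F hF hδ i j

/-! ### Transposition -/

/-- [cite: NunezFernandezEtAl2025, §3.3.1]; [cite: CortinovisKressnerMassei2020, §3
Algorithm 1] Complete pivoting is symmetric under transposition. -/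
theorem IsCompletePivoted.transpose {A : Matrix m n K} {r : Fin k → m} {c : Fin k → n}
    (h : IsCompletePivoted A r c) : IsCompletePivoted Aᵀ c r := by
  induction h with
  | nil => exact .nil
  | @cons k r c i j _ hne hmax ih =>
    refine ih.cons ?_ fun y x => ?_
    · rwa [transpose_sub_crossInterp_apply]
    · rw [transpose_sub_crossInterp_apply, transpose_sub_crossInterp_apply]
      exact hmax x y

/-! ### Rank and termination -/

/-- [cite: CortinovisKressnerMassei2020, §3.1 (the growth factor is a supremum over matrices
of rank at least `k`: "This condition ensures that there is no breakdown in the first `k` steps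
of Algorithm 1")]; [cite: Bebendorf2000, §2 Lemma 2] Conversely, `k` complete-pivoting steps
without breakdown force `rank A ≥ k`. -/
theorem IsCompletePivoted.le_rank [Fintype n] {A : Matrix m n K} {r : Fin k → m}
    {c : Fin k → n} (h : IsCompletePivoted A r c) : k ≤ A.rank := by
  simpa using card_le_rank_of_isUnit_det_submatrix A h.isUnit_det

/-- [cite: CortinovisKressnerMassei2020, §1 ("if `A(I,J)` is invertible then the matrix
`A(:,J) A(I,J)⁻¹ A(I,:)` has rank `k`"), §3.1 (no breakdown in the first `k` steps when
`rank A ≥ k`)]; [cite: NunezFernandezEtAl2025, §3.1 properties (i)–(ii) (exactness when the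
number of pivots equals the rank)] After `k` complete-pivoting steps the residual is nonzero iff
`k < rank A`. -/
theorem IsCompletePivoted.crossInterp_ne_self_iff [Fintype n] {A : Matrix m n K}
    {r : Fin k → m} {c : Fin k → n} (h : IsCompletePivoted A r c) :
    crossInterp A r c ≠ A ↔ k < A.rank := by
  rw [Ne, crossInterp_eq_self_iff_rank_eq A h.isUnit_det, Fintype.card_fin]
  exact ⟨fun hk => lt_of_le_of_ne h.le_rank (Ne.symm hk), fun hk => hk.ne'⟩

/-! ### A diagonal cross step is a step of Gaussian elimination -/

/-- [cite: CortinovisKressnerMassei2020, §3 Algorithm 1 (line 6, `R_{k+1} := R_k -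
p_{k+1}⁻¹ R_k(:, j_{k+1}) R_k(i_{k+1}, :)`)]; [cite: GolubVanLoan2013, §4.1.1 (4.1.2)] Appending
a DIAGONAL cross `(p, p)` performs one step of Gaussian elimination on the residual
`E = A - Ã`: `(A - Ã⁺) x y = E x y - E x p (E p p)⁻¹ E p y`. -/
theorem sub_crossInterp_vecCons_vecCons_self_apply (A : Matrix n n K) (r : Fin k → n)
    (hP : IsUnit (A.submatrix r r).det) {p : n} (hγ : (A - crossInterp A r r) p p ≠ 0)
    (x y : n) :
    (A - crossInterp A (vecCons p r) (vecCons p r)) x y =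
      (A - crossInterp A r r) x y - (A - crossInterp A r r) x p *
        ((A - crossInterp A r r) p p)⁻¹ * (A - crossInterp A r r) p y := by
  rw [sub_crossInterp_vecCons_vecCons_apply A r r hP (isUnit_iff_ne_zero.mpr hγ) x y,
    Ring.inverse_eq_inv']

end NormedField

/-! ### Symmetric positive semidefinite matrices: diagonal pivoting is complete pivoting -/

section PosSemidef

variable {n : Type*} [Fintype n] {A : Matrix n n ℝ} {k : ℕ}

/-- [cite: CortinovisKressnerMassei2020, §3 Remark 5 ("Both for SPSD and DD matrices, the
element of maximum modulus is on the diagonal"), §3.2]; [cite: GolubVanLoan2013, §4.2.8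
Theorem 4.2.8 (4.2.14)] For a symmetric positive semidefinite matrix a diagonally pivoted
sequence (pivoted Cholesky / ACA restricted to the diagonal) IS a completely pivoted sequence. -/
theorem IsDiagPivoted.isCompletePivoted (hA : A.PosSemidef) {r : Fin k → n}
    (h : IsDiagPivoted A r) : IsCompletePivoted A r r := by
  induction h with
  | nil => exact .nil
  | cons h₀ hne hmax ih =>
    refine ih.cons hne fun x y => ?_
    rw [Real.norm_eq_abs, Real.norm_eq_abs]
    exact (abs_sub_crossInterp_le_pivot_of_forall_diag_le hA _ (h₀.isUnit_det hA) hmax x y).trans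
      (le_abs_self _)

end PosSemidef

/-! ### Diagonally dominant matrices -/

section DiagDominant

variable {K : Type*} [NormedField K] {n : Type*} [Fintype n] [DecidableEq n] {k : ℕ}

/-! #### Row diagonal dominance: elementary consequences

Row diagonal dominance (by rows, NOT necessarily strict) is used as the inline hypothesis
`∀ i, ∑ j ∈ univ.erase i, ‖A i j‖ ≤ ‖A i i‖`, in the style of Mathlib's Gershgorin file
(`Matrix.det_ne_zero_of_sum_row_lt_diag` is the strict version). -/

/-- [cite: HornJohnson2013, §6.1 Definition 6.1.9]; [cite: CortinovisKressnerMassei2020, §2.2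
Definition 2] In a diagonally dominant row every entry is dominated by the diagonal one. -/
theorem norm_apply_le_norm_diag_of_sum_erase_le {A : Matrix n n K} {i : n}
    (hi : ∑ j ∈ univ.erase i, ‖A i j‖ ≤ ‖A i i‖) (j : n) : ‖A i j‖ ≤ ‖A i i‖ := by
  by_cases hj : j = i
  · rw [hj]
  · exact (Finset.single_le_sum (fun y _ => norm_nonneg (A i y))
      (Finset.mem_erase.mpr ⟨hj, Finset.mem_univ j⟩)).trans hi

/-- [cite: HornJohnson2013, §6.1 Definition 6.1.9]; [cite: Higham2011, §"Structured Matrices"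
(diagonal dominance by rows gives `ρ_n ≤ 2`)] The absolute row sum of a diagonally
dominant row is at most twice the diagonal modulus. -/
theorem sum_norm_le_two_mul_norm_diag_of_sum_erase_le {A : Matrix n n K} {i : n}
    (hi : ∑ j ∈ univ.erase i, ‖A i j‖ ≤ ‖A i i‖) : ∑ j, ‖A i j‖ ≤ 2 * ‖A i i‖ := by
  rw [← Finset.add_sum_erase _ _ (mem_univ i)]
  linarith

/-- [cite: CortinovisKressnerMassei2020, §3 Remark 5 ("the element of maximum modulus is on
the diagonal")]; [cite: HornJohnson2013, §6.1 Definition 6.1.9] In a row diagonally dominant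
matrix a diagonal entry of maximum modulus has maximum modulus among ALL entries — so the search
for a complete pivot may be restricted to the diagonal. -/
theorem norm_apply_le_of_forall_norm_diag_le {A : Matrix n n K}
    (hA : ∀ i, ∑ j ∈ univ.erase i, ‖A i j‖ ≤ ‖A i i‖) {p : n} (hp : ∀ x, ‖A x x‖ ≤ ‖A p p‖)
    (x y : n) : ‖A x y‖ ≤ ‖A p p‖ :=
  (norm_apply_le_norm_diag_of_sum_erase_le (hA x) y).trans (hp x)

/-! #### One step of Gaussian elimination preserves row diagonal dominance -/

/-- [cite: GolubVanLoan2013, §4.1.1 Theorem 4.1.1, proof via (4.1.2) (the column version,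
transposed here)]; [cite: Higham2011, §"LU Factorization" ("diagonal dominance ... [is] inherited
by the Schur complement")] One elimination step with a pivot `E p p ≠ 0` whose ROW is
diagonally dominant does not increase any absolute row sum:
`Σ_y ‖E x y - E x p (E p p)⁻¹ E p y‖ ≤ Σ_y ‖E x y‖`. -/
theorem sum_norm_sub_mul_inv_mul_le_sum_norm (E : Matrix n n K) {p : n} (hγ : E p p ≠ 0)
    (hp : ∑ y ∈ univ.erase p, ‖E p y‖ ≤ ‖E p p‖) (x : n) :
    ∑ y, ‖E x y - E x p * (E p p)⁻¹ * E p y‖ ≤ ∑ y, ‖E x y‖ := by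
  have hγ' : 0 < ‖E p p‖ := norm_pos_iff.mpr hγ
  have hpp : E x p - E x p * (E p p)⁻¹ * E p p = 0 := by
    rw [mul_assoc, inv_mul_cancel₀ hγ, mul_one, sub_self]
  rw [← Finset.add_sum_erase _ (fun y => ‖E x y - E x p * (E p p)⁻¹ * E p y‖) (mem_univ p),
    hpp, norm_zero, zero_add]
  calc ∑ y ∈ univ.erase p, ‖E x y - E x p * (E p p)⁻¹ * E p y‖
      ≤ ∑ y ∈ univ.erase p, (‖E x y‖ + ‖E x p‖ / ‖E p p‖ * ‖E p y‖) :=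
        Finset.sum_le_sum fun y _ => by
          calc ‖E x y - E x p * (E p p)⁻¹ * E p y‖
              ≤ ‖E x y‖ + ‖E x p * (E p p)⁻¹ * E p y‖ := norm_sub_le _ _
            _ = ‖E x y‖ + ‖E x p‖ / ‖E p p‖ * ‖E p y‖ := by
                rw [norm_mul, norm_mul, norm_inv, div_eq_mul_inv]
    _ = ∑ y ∈ univ.erase p, ‖E x y‖ + ‖E x p‖ / ‖E p p‖ * ∑ y ∈ univ.erase p, ‖E p y‖ := by
        rw [Finset.sum_add_distrib, Finset.mul_sum]
    _ ≤ ∑ y ∈ univ.erase p, ‖E x y‖ + ‖E x p‖ / ‖E p p‖ * ‖E p p‖ := by gcongr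
    _ = ∑ y ∈ univ.erase p, ‖E x y‖ + ‖E x p‖ := by rw [div_mul_cancel₀ _ hγ'.ne']
    _ = ∑ y, ‖E x y‖ := by
        rw [add_comm, Finset.add_sum_erase _ (fun y => ‖E x y‖) (mem_univ p)]

/-- [cite: GolubVanLoan2013, §4.1.1 Theorem 4.1.1, proof via (4.1.2) (transposed)];
[cite: Higham2011, §"LU Factorization"]; [cite: CortinovisKressnerMassei2020, §3 Remark 5
("diagonal dominance [is] preserved by taking Schur complements")] One elimination step with a pivot
`E p p ≠ 0` of a ROW DIAGONALLY DOMINANT matrix `E` produces a row diagonally dominant matrix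
`E' = E - E[:, p] (E p p)⁻¹ E[p, :]` (the Schur complement bordered by a zero row and column):
`Σ_{y ≠ x} ‖E' x y‖ ≤ ‖E' x x‖` for every `x`. -/
theorem sum_erase_norm_sub_mul_inv_mul_le_norm (E : Matrix n n K) {p : n} (hγ : E p p ≠ 0)
    (hE : ∀ x, ∑ y ∈ univ.erase x, ‖E x y‖ ≤ ‖E x x‖) (x : n) :
    ∑ y ∈ univ.erase x, ‖E x y - E x p * (E p p)⁻¹ * E p y‖ ≤
      ‖E x x - E x p * (E p p)⁻¹ * E p x‖ := by
  have hγ' : 0 < ‖E p p‖ := norm_pos_iff.mpr hγ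
  by_cases hx : x = p
  · subst hx
    have h0 : ∀ y, E x y - E x x * (E x x)⁻¹ * E x y = 0 := fun y => by
      rw [mul_inv_cancel₀ hγ, one_mul, sub_self]
    simp [h0]
  · have hp_mem : p ∈ univ.erase x := mem_erase.mpr ⟨Ne.symm hx, mem_univ p⟩
    have hx_mem : x ∈ univ.erase p := mem_erase.mpr ⟨hx, mem_univ x⟩
    have hpp : E x p - E x p * (E p p)⁻¹ * E p p = 0 := by
      rw [mul_assoc, inv_mul_cancel₀ hγ, mul_one, sub_self]
    rw [← Finset.add_sum_erase _ (fun y => ‖E x y - E x p * (E p p)⁻¹ * E p y‖) hp_mem, hpp,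
      norm_zero, zero_add]
    set S := (univ.erase x).erase p with hS
    have h1 : ∑ y ∈ S, ‖E x y - E x p * (E p p)⁻¹ * E p y‖ ≤
        ∑ y ∈ S, ‖E x y‖ + ‖E x p‖ / ‖E p p‖ * ∑ y ∈ S, ‖E p y‖ := by
      calc ∑ y ∈ S, ‖E x y - E x p * (E p p)⁻¹ * E p y‖
          ≤ ∑ y ∈ S, (‖E x y‖ + ‖E x p‖ / ‖E p p‖ * ‖E p y‖) :=
            Finset.sum_le_sum fun y _ => by
              calc ‖E x y - E x p * (E p p)⁻¹ * E p y‖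
                  ≤ ‖E x y‖ + ‖E x p * (E p p)⁻¹ * E p y‖ := norm_sub_le _ _
                _ = ‖E x y‖ + ‖E x p‖ / ‖E p p‖ * ‖E p y‖ := by
                    rw [norm_mul, norm_mul, norm_inv, div_eq_mul_inv]
        _ = ∑ y ∈ S, ‖E x y‖ + ‖E x p‖ / ‖E p p‖ * ∑ y ∈ S, ‖E p y‖ := by
            rw [Finset.sum_add_distrib, Finset.mul_sum]
    have h2 : ∑ y ∈ S, ‖E x y‖ + ‖E x p‖ ≤ ‖E x x‖ := by
      rw [add_comm, hS, Finset.add_sum_erase _ (fun y => ‖E x y‖) hp_mem]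
      exact hE x
    have h3 : ∑ y ∈ S, ‖E p y‖ + ‖E p x‖ ≤ ‖E p p‖ := by
      rw [add_comm, hS, Finset.erase_right_comm,
        Finset.add_sum_erase _ (fun y => ‖E p y‖) hx_mem]
      exact hE p
    have h4 : ‖E x x‖ - ‖E x p‖ * ‖E p x‖ / ‖E p p‖ ≤ ‖E x x - E x p * (E p p)⁻¹ * E p x‖ := by
      have := norm_sub_norm_le (E x x) (E x p * (E p p)⁻¹ * E p x)
      rw [norm_mul, norm_mul, norm_inv] at this
      convert this using 2
      ring
    have h5 : ‖E x p‖ / ‖E p p‖ * ∑ y ∈ S, ‖E p y‖ ≤ ‖E x p‖ / ‖E p p‖ * (‖E p p‖ - ‖E p x‖) :=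
      mul_le_mul_of_nonneg_left (by linarith) (by positivity)
    have h6 : ‖E x p‖ / ‖E p p‖ * (‖E p p‖ - ‖E p x‖) = ‖E x p‖ - ‖E x p‖ * ‖E p x‖ / ‖E p p‖ := by
      field_simp
    linarith

/-! #### Complete pivoting on a row diagonally dominant matrix -/

/-- [folklore] The induction behind the next four theorems: along a completely pivoted DIAGONAL
sequence of a row diagonally dominant matrix, the residual stays row diagonally dominant, its
absolute row sums do not increase, and every absolute row sum is at most twice the modulus of
every pivot found so far. -/
private theorem rowDiagDominant_aux {A : Matrix n n K}
    (hA : ∀ i, ∑ j ∈ univ.erase i, ‖A i j‖ ≤ ‖A i i‖) :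
    ∀ {k : ℕ} {r c : Fin k → n}, IsCompletePivoted A r c → r = c →
      (∀ x, ∑ y ∈ univ.erase x, ‖(A - crossInterp A r r) x y‖ ≤ ‖(A - crossInterp A r r) x x‖) ∧
      (∀ x, ∑ y, ‖(A - crossInterp A r r) x y‖ ≤ ∑ y, ‖A x y‖) ∧
      (∀ s x, ∑ y, ‖(A - crossInterp A r r) x y‖ ≤ 2 * ‖crossPivot A r r s‖) := by
  intro k r c h
  induction h with
  | nil =>
    intro _
    refine ⟨fun x => by simpa using hA x, fun x => by simp, fun s => s.elim0⟩
  | @cons k r₀ c₀ i j h₀ hne hmax ih =>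
    intro hrc
    have hij : j = i := by simpa using (congr_fun hrc 0).symm
    have h0 : r₀ = c₀ := by
      funext t
      simpa using congr_fun hrc t.succ
    subst hij h0
    obtain ⟨hDD, hrow, hpiv⟩ := ih rfl
    have step := sub_crossInterp_vecCons_vecCons_self_apply A r₀ h₀.isUnit_det hne
    refine ⟨fun x => ?_, fun x => ?_, fun s x => ?_⟩
    · simp only [step]
      exact sum_erase_norm_sub_mul_inv_mul_le_norm _ hne hDD x
    · simp only [step]
      exact (sum_norm_sub_mul_inv_mul_le_sum_norm _ hne (hDD j) x).trans (hrow x)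
    · simp only [step]
      refine Fin.cases ?_ (fun t => ?_) s
      · rw [crossPivot_cons_zero]
        calc ∑ y, ‖(A - crossInterp A r₀ r₀) x y - (A - crossInterp A r₀ r₀) x j *
                ((A - crossInterp A r₀ r₀) j j)⁻¹ * (A - crossInterp A r₀ r₀) j y‖
            ≤ ∑ y, ‖(A - crossInterp A r₀ r₀) x y‖ :=
              sum_norm_sub_mul_inv_mul_le_sum_norm _ hne (hDD j) x
          _ ≤ 2 * ‖(A - crossInterp A r₀ r₀) x x‖ :=
              sum_norm_le_two_mul_norm_diag_of_sum_erase_le (hDD x)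
          _ ≤ 2 * ‖(A - crossInterp A r₀ r₀) j j‖ := by linarith [hmax x x]
      · rw [crossPivot_cons_succ]
        exact (sum_norm_sub_mul_inv_mul_le_sum_norm _ hne (hDD j) x).trans (hpiv t x)

/-- [cite: CortinovisKressnerMassei2020, §3 Remark 5 ("diagonal dominance [is] preserved by
taking Schur complements"; `R_k = [0 0; 0 A^{(k)}]`)]; [cite: Higham2011, §"LU Factorization"];
[cite: GolubVanLoan2013, §4.1.1 Theorem 4.1.1] Along a completely pivoted diagonal sequence the
residual `A - Ã` of a row diagonally dominant matrix is row diagonally dominant. -/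
theorem IsCompletePivoted.sum_erase_norm_sub_crossInterp_le {A : Matrix n n K}
    (hA : ∀ i, ∑ j ∈ univ.erase i, ‖A i j‖ ≤ ‖A i i‖) {r : Fin k → n}
    (h : IsCompletePivoted A r r) (x : n) :
    ∑ y ∈ univ.erase x, ‖(A - crossInterp A r r) x y‖ ≤ ‖(A - crossInterp A r r) x x‖ :=
  (rowDiagDominant_aux hA h rfl).1 x

/-- [cite: GolubVanLoan2013, §4.1.1 Theorem 4.1.1, proof via (4.1.2)]; [cite: Higham2011,
§"Structured Matrices"] Along a completely pivoted diagonal sequence the absolute row sums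
of the residual of a row diagonally dominant matrix do not exceed those of `A`. -/
theorem IsCompletePivoted.sum_norm_sub_crossInterp_le_sum_norm {A : Matrix n n K}
    (hA : ∀ i, ∑ j ∈ univ.erase i, ‖A i j‖ ≤ ‖A i i‖) {r : Fin k → n}
    (h : IsCompletePivoted A r r) (x : n) :
    ∑ y, ‖(A - crossInterp A r r) x y‖ ≤ ∑ y, ‖A x y‖ :=
  (rowDiagDominant_aux hA h rfl).2.1 x

/-- [cite: Higham2011, §"Structured Matrices" ("if `A` is diagonally dominant by rows ... the
growth factor satisfies `ρ_n ≤ 2`")]; [cite: CortinovisKressnerMassei2020, §3.3 ("one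
obtains `ρ_k ≤ 2`; see Theorem 13.8 in [Higham2002]")] NO GROWTH BEYOND `2`: every residual
entry is bounded by twice the original diagonal modulus of its row,
`‖(A - Ã) x y‖ ≤ Σ_y ‖A x y‖ ≤ 2 ‖A x x‖`. -/
theorem IsCompletePivoted.norm_sub_crossInterp_le_two_mul_norm_diag {A : Matrix n n K}
    (hA : ∀ i, ∑ j ∈ univ.erase i, ‖A i j‖ ≤ ‖A i i‖) {r : Fin k → n}
    (h : IsCompletePivoted A r r) (x y : n) :
    ‖(A - crossInterp A r r) x y‖ ≤ 2 * ‖A x x‖ :=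
  calc ‖(A - crossInterp A r r) x y‖ ≤ ∑ y, ‖(A - crossInterp A r r) x y‖ :=
      Finset.single_le_sum (fun _ _ => norm_nonneg _) (mem_univ y)
    _ ≤ ∑ y, ‖A x y‖ := h.sum_norm_sub_crossInterp_le_sum_norm hA x
    _ ≤ 2 * ‖A x x‖ := sum_norm_le_two_mul_norm_diag_of_sum_erase_le (hA x)

/-- [cite: CortinovisKressnerMassei2020, §3.3 (`ρ_k ≤ 2` for DD matrices), §3.1 proof of
Theorem 6 (the chain `p_{m+1} = ‖A^{(m)}‖_max ≤ ρ_j ‖A^{(m-j)}‖_max = ρ_j |p_{m-j+1}|`)];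
[cite: Higham2011, §"Structured Matrices"] THE GROWTH FACTOR OF A ROW DIAGONALLY
DOMINANT MATRIX IS AT MOST `2`, instance by instance: along a completely pivoted diagonal
sequence every later pivot has modulus at most twice that of every earlier pivot,
`|p_{k+1}| ≤ 2 |pₛ|`. -/
theorem IsCompletePivoted.norm_crossPivot_zero_le_two_mul {A : Matrix n n K}
    (hA : ∀ i, ∑ j ∈ univ.erase i, ‖A i j‖ ≤ ‖A i i‖) {r : Fin k → n} {p : n}
    (h : IsCompletePivoted A (vecCons p r) (vecCons p r)) (s : Fin (k + 1)) :
    ‖crossPivot A (vecCons p r) (vecCons p r) 0‖ ≤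
      2 * ‖crossPivot A (vecCons p r) (vecCons p r) s‖ := by
  refine Fin.cases (by linarith [norm_nonneg (crossPivot A (vecCons p r) (vecCons p r) 0)])
    (fun t => ?_) s
  rw [crossPivot_cons_zero, crossPivot_cons_succ]
  calc ‖(A - crossInterp A r r) p p‖ ≤ ∑ y, ‖(A - crossInterp A r r) p y‖ :=
      Finset.single_le_sum (fun _ _ => norm_nonneg _) (mem_univ p)
    _ ≤ 2 * ‖crossPivot A r r t‖ := (rowDiagDominant_aux hA h.cons_inv.1 rfl).2.2 t p

/-- [cite: CortinovisKressnerMassei2020, §3 Remark 5 ("the search for the pivot element in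
Step 3 can be restricted to the diagonal for such matrices")] For a row diagonally dominant
matrix, a nonzero residual DIAGONAL entry of maximum modulus among the residual diagonal is a
complete pivot. -/
theorem IsCompletePivoted.cons_of_rowDiagDominant {A : Matrix n n K}
    (hA : ∀ i, ∑ j ∈ univ.erase i, ‖A i j‖ ≤ ‖A i i‖) {r : Fin k → n}
    (h : IsCompletePivoted A r r) {p : n} (hne : (A - crossInterp A r r) p p ≠ 0)
    (hmax : ∀ x, ‖(A - crossInterp A r r) x x‖ ≤ ‖(A - crossInterp A r r) p p‖) :
    IsCompletePivoted A (vecCons p r) (vecCons p r) :=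
  h.cons hne (norm_apply_le_of_forall_norm_diag_le (h.sum_erase_norm_sub_crossInterp_le hA) hmax)

/-- [cite: CortinovisKressnerMassei2020, §3 Remark 5, Algorithm 1]; [cite: HornJohnson2013,
§6.1 Definition 6.1.9] For a row diagonally dominant matrix the diagonal search never gets stuck
before the residual vanishes: if `Ã ≠ A` after `k` diagonal complete-pivoting steps, some
residual diagonal entry is a valid `(k+1)`-st complete pivot (a diagonally dominant row with zero
diagonal entry is zero). -/
theorem IsCompletePivoted.exists_cons_of_rowDiagDominant {A : Matrix n n K}
    (hA : ∀ i, ∑ j ∈ univ.erase i, ‖A i j‖ ≤ ‖A i i‖) {r : Fin k → n}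
    (h : IsCompletePivoted A r r) (hne : crossInterp A r r ≠ A) :
    ∃ p, IsCompletePivoted A (vecCons p r) (vecCons p r) := by
  have hDD := h.sum_erase_norm_sub_crossInterp_le hA
  have hall : ¬ ∀ x, (A - crossInterp A r r) x x = 0 := fun hall => hne <| by
    ext x y
    have hxy := norm_apply_le_norm_diag_of_sum_erase_le (hDD x) y
    rw [hall x, norm_zero, norm_le_zero_iff, Matrix.sub_apply, sub_eq_zero] at hxy
    exact hxy.symm
  obtain ⟨x₀, hx₀⟩ := not_forall.mp hall
  haveI : Nonempty n := ⟨x₀⟩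
  obtain ⟨p, hp⟩ := Finite.exists_max fun x => ‖(A - crossInterp A r r) x x‖
  refine ⟨p, h.cons_of_rowDiagDominant hA (fun hp0 => hx₀ ?_) hp⟩
  have := hp x₀
  rwa [hp0, norm_zero, norm_le_zero_iff] at this

/-! #### The error bound for diagonally dominant matrices -/

/-- [cite: CortinovisKressnerMassei2020, §3.1 Theorem 7 combined with §3.3 (`ρ_m ≤ 2` for DD
matrices) — i.e. Corollary 9 at the strength of Theorem 7, `‖A - Ã_m‖_max ≤ 2^{2m+2} γ_m(A)`;
the sharper constant `(m+1) 2^{m+1} σ_{m+1}(A)` PRINTED in Corollary 9 rests on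
`‖U₁₁⁻¹‖ ≤ m + 1` for DD matrices and is NOT formalised here]; [cite: Higham2011, §"Structured
Matrices"] CROSS APPROXIMATION OF A ROW DIAGONALLY DOMINANT MATRIX.  After `k` steps of
Algorithm 1 with the pivot search restricted to the diagonal (which is complete pivoting, by
Remark 5), if `A` is entrywise `δ`-close to some matrix of rank `≤ k` then
`‖A - Ã_k‖_max ≤ 2 · (4^{k+1} - 1)/3 · δ` — Theorem 7 with the growth factor `ρ ≤ 2` of
diagonally dominant matrices. -/
theorem IsCompletePivoted.norm_sub_crossInterp_le_of_rowDiagDominant_of_rank_le {A : Matrix n n K}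
    (hA : ∀ i, ∑ j ∈ univ.erase i, ‖A i j‖ ≤ ‖A i i‖) {r : Fin k → n}
    (h : IsCompletePivoted A r r) (F : Matrix n n K) (hF : F.rank ≤ k) {δ : ℝ}
    (hδ : ∀ a b, ‖A a b - F a b‖ ≤ δ) (x y : n) :
    ‖(A - crossInterp A r r) x y‖ ≤ 2 * ((4 ^ (k + 1) - 1) / 3) * δ := by
  have hδ0 : 0 ≤ δ := (norm_nonneg _).trans (hδ x y)
  by_cases hex : crossInterp A r r = A
  · rw [hex, sub_self, Matrix.zero_apply, norm_zero]
    have : (1 : ℝ) ≤ 4 ^ (k + 1) := one_le_pow₀ (by norm_num)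
    have : (0 : ℝ) ≤ (4 ^ (k + 1) - 1) / 3 := by
      apply div_nonneg _ (by norm_num)
      linarith
    positivity
  · obtain ⟨p, hp⟩ := h.exists_cons_of_rowDiagDominant hA hex
    exact hp.norm_sub_crossInterp_le_mul_of_rank_le (hp.norm_crossPivot_zero_le_two_mul hA)
      F hF hδ x y

/-- [cite: CortinovisKressnerMassei2020, §3.1 Theorem 7 with §3.3 (`2^{2m+1} · ρ_m · γ_m(A)`
with `ρ_m ≤ 2`, `m = k`)] The same bound with the printed power of two:
`‖A - Ã_k‖_max ≤ 2^{2k+2} δ`. -/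
theorem IsCompletePivoted.norm_sub_crossInterp_le_two_pow_mul_of_rowDiagDominant_of_rank_le
    {A : Matrix n n K} (hA : ∀ i, ∑ j ∈ univ.erase i, ‖A i j‖ ≤ ‖A i i‖) {r : Fin k → n}
    (h : IsCompletePivoted A r r) (F : Matrix n n K) (hF : F.rank ≤ k) {δ : ℝ}
    (hδ : ∀ a b, ‖A a b - F a b‖ ≤ δ) (x y : n) :
    ‖(A - crossInterp A r r) x y‖ ≤ 2 ^ (2 * k + 2) * δ := by
  have hδ0 : 0 ≤ δ := (norm_nonneg _).trans (hδ x y)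
  calc ‖(A - crossInterp A r r) x y‖ ≤ 2 * ((4 ^ (k + 1) - 1) / 3) * δ :=
      h.norm_sub_crossInterp_le_of_rowDiagDominant_of_rank_le hA F hF hδ x y
    _ ≤ 2 * 2 ^ (2 * k + 1) * δ := by
      gcongr
      exact four_pow_succ_sub_one_div_three_le k
    _ = 2 ^ (2 * k + 2) * δ := by ring

/-- [cite: CortinovisKressnerMassei2020, §3.1 Theorem 7 with §3.3, lower-bound reading] For a
row diagonally dominant matrix, a nonzero residual diagonal entry after `k` diagonal
complete-pivoting steps certifies that no matrix of rank `≤ k` is entrywise closer to `A` than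
`max_x ‖(A - Ã_k) x x‖ / (2 (4^{k+1} - 1)/3)`. -/
theorem IsCompletePivoted.norm_diag_sub_crossInterp_le_of_rowDiagDominant_of_rank_le
    {A : Matrix n n K} (hA : ∀ i, ∑ j ∈ univ.erase i, ‖A i j‖ ≤ ‖A i i‖) {r : Fin k → n}
    (h : IsCompletePivoted A r r) (F : Matrix n n K) (hF : F.rank ≤ k) {δ : ℝ}
    (hδ : ∀ a b, ‖A a b - F a b‖ ≤ δ) (x : n) :
    ‖(A - crossInterp A r r) x x‖ ≤ 2 * ((4 ^ (k + 1) - 1) / 3) * δ :=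
  h.norm_sub_crossInterp_le_of_rowDiagDominant_of_rank_le hA F hF hδ x x

/-! #### Column diagonal dominance, by transposition -/

/-- [cite: CortinovisKressnerMassei2020, §3.1 Theorem 7 with §3.3, §2.2 Definition 2 ("doubly
DD": `A` and `A^*` DD)]; [cite: GolubVanLoan2013, §4.1.1 Theorem 4.1.1 (diagonal dominance by
columns is the version printed there)]; [cite: Higham2011, §"Structured Matrices" ("or `A` is
diagonally dominant by columns (that is, `Aᵀ` is diagonally dominant by rows)")] The error
bound for a COLUMN diagonally dominant matrix, by transposition:
`‖A - Ã_k‖_max ≤ 2 (4^{k+1} - 1)/3 · δ`. -/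
theorem IsCompletePivoted.norm_sub_crossInterp_le_of_colDiagDominant_of_rank_le
    {A : Matrix n n K} (hA : ∀ j, ∑ i ∈ univ.erase j, ‖A i j‖ ≤ ‖A j j‖) {r : Fin k → n}
    (h : IsCompletePivoted A r r) (F : Matrix n n K) (hF : F.rank ≤ k) {δ : ℝ}
    (hδ : ∀ a b, ‖A a b - F a b‖ ≤ δ) (x y : n) :
    ‖(A - crossInterp A r r) x y‖ ≤ 2 * ((4 ^ (k + 1) - 1) / 3) * δ := by
  rw [← transpose_sub_crossInterp_apply A r r x y]
  exact h.transpose.norm_sub_crossInterp_le_of_rowDiagDominant_of_rank_le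
    (fun i => by simpa using hA i) Fᵀ (by simpa using hF) (fun a b => by simpa using hδ b a) y x

end DiagDominant

end Literature.LinearAlgebra.Matrix
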